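import HarnessLib.Audit.LibrarySuggestionsDenyListCorCM
import Summits.HodgeConjecture.CorCM.HypLiu418.A3Liu418GSInstance
import Literature.NumberTheory.Automorphic.Liu2021.AppendixC.HeckeImage
import Literature.AlgebraicGeometry.Motives.AbelianVarietyRosatiPositiveInvolution
import Literature.AlgebraicGeometry.Motives.AbelianVarietyEndRatOfIsogeny
import Literature.AlgebraicGeometry.Motives.JacobianThetaDivisor
import Literature.AlgebraicGeometry.Motives.JacobianGaloisCoverNormAdjoint
import Literature.NumberTheory.ComplexMultiplication.EllipticCurveEndomorphismsBaseChange
import Literature.AlgebraicGeometry.Motives.AbelianVarietyLevelAdjointFan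
import Literature.AlgebraicGeometry.Motives.AmpleDivisorBiproduct
import Literature.NumberTheory.Automorphic.Liu2021.AlbaneseBaseChangeComplexSplit
import Literature.AlgebraicGeometry.Motives.AlbaneseDimensionBaseChange
import Literature.AlgebraicGeometry.Motives.AbelianVarietyBiproductIsogenies
import Literature.AlgebraicGeometry.Motives.AbelianVarietyProjectiveChart
import Literature.NumberTheory.Automorphic.Liu2021.AlbaneseComplexJacobianModel
import Literature.AlgebraicGeometry.Morphisms.CofanPieceMapFamily
import Literature.AlgebraicGeometry.ShimuraVarieties.UnitaryShimuraCurveTranslateRigidity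
import Summits.HodgeConjecture.CorCM.HypLiu418.A3Liu418GSRosHLetters
import HarnessLib



/-!
# d6 line `a3_liu418`, `stub_RosH` GLUE (s214 (4) tree-first BARE): `SocketRosH` at the GS tower from the FACTS (F-R), (F-P2)

STRUCTURE-FREE filing draft v3 (A-p02 (g14), (L) pen).  FINAL TEMPLATE: `ext_C` ↦ ★ `exists_levelAdjoint_letters_GS` (A-p18 (g12) BARE `A3Liu418GSRosHLetters`) by import; HEAD ★ p764022 by import; 0 sorry.
HC_CM is proved only modulo the 7 printed citations until rung 0 closes.
-/

set_option autoImplicit false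

noncomputable section

namespace Summit.HodgeConjecture.CorCM.Lines.A3Liu418

open CategoryTheory AlgebraicGeometry NumberField Function MonoidalCategory
open Literature.AlgebraicGeometry.Motives.AbelianVariety (bcFunctor)
open Literature.AlgebraicGeometry.Motives Literature.AlgebraicGeometry.Motives.AbelianVariety
open Literature.AlgebraicGeometry.ShimuraVarieties.UnitaryCanonicalModel
open Literature.NumberTheory.Automorphic Literature.NumberTheory.Automorphic.UnitaryGroup
open Literature.NumberTheory.Automorphic.Liu2021 Literature.NumberTheory.Automorphic.Liu2021.AppendixC
open Literature.NumberTheory.ComplexMultiplication (endAlgebraBaseChange_injective)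
open Literature.RingTheory.CentralSimple
open Literature.Geometry.Kaehler Literature.Geometry.Kaehler.ComplexTorus
open Literature.NumberTheory.Transcendental Literature.AlgebraicGeometry.HodgeTheory

section Glue

variable {F : CMField} {ι₁ : F →+* ℂ} {Jstar : Matrix (Fin 2) (Fin 2) F}
  {K₀ : C5.OpenCompactSubgroup ↥(finAdelic (↥(maximalRealSubfield F)) F (IsCMField.complexConj F) 2 Jstar)}
  (S : RecordSystemGS F Jstar ι₁ K₀) (hU7ₛ : S.HeckeTranslateDefinedOver) (hLQ : S.IsLevelQuotient)
  (h4 : 4 ≤ Module.finrank ℚ F) (isoₛ : ℕ → Prop)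

/-- ★-only: in `H := ℚ[s]` the generators, seen as elements of `↥H`, generate `⊤`. -/
theorem adjoin_coe_preimage_eq_top {R A : Type*} [CommSemiring R] [Semiring A] [Algebra R A] (s : Set A) :
    Algebra.adjoin R ((Subtype.val : ↥(Algebra.adjoin R s) → A) ⁻¹' s) = ⊤ := by
  apply Subalgebra.map_injective (f := (Algebra.adjoin R s).val) Subtype.val_injective
  rw [AlgHom.map_adjoin, Algebra.map_top, Subalgebra.range_val, Subalgebra.coe_val,
    Set.image_preimage_eq_of_subset]
  rw [Subtype.range_coe_subtype]
  exact Algebra.subset_adjoin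

/-- **(PF) PIECEWISE-TRIVIAL ⇒ TRIVIAL for the deck groups of the GS tower** (the (L)-pen ruling 06:09:13Z on the multiplicity obstruction):
at the complex place `ῑ₁ = algebraMap F ℂ` (so that `X_N ⊗ ℂ = (M_N ⊗_c F) ⊗_{ῑ₁} ℂ ≅ M_N ⊗_{ι₁} ℂ`, ★ `baseChangeHomObjIsoOfComp`), a deck
transformation `act δ = T_k` (`k ∈ K`) of `X_N` that fixes a nonempty open of `X_N ⊗ ℂ` pointwise is `1` — transport of A-p04 (g16)'s HEAD `RecordSystemGS.heckeTranslate_eq_id_of_comp_eq` along the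
natural comparison ★ `baseChangeHomObjIsoOfComp_comm`.  Consumed by ★ p763059 ed.2 (`m c′` constant) and (G4Σ) Layer 2.
[cite: Milne2005ShimuraVarieties, §5 p. 57 L7–12 and Rem. 5.29 (c) p. 65] [cite: Liu2021, §4.2] -/
theorem translateRigidity_GS [Algebra (F : Type) ℂ] (hA : (algebraMap (F : Type) ℂ).comp (cmConjRingHom F) = ι₁)
    (N : C5.SmallLevel K₀) {K : C5.SmallLevel K₀} (hn : ∀ k ∈ K.1.1, C5.HeckeLE k N N)
    {Δ : Type} [Group Δ] (act : Δ →* Aut ((sec42DataGS S h4 isoₛ).X N))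
    (hact : ∀ δ, ∃ (k : ↥(finAdelic (↥(maximalRealSubfield F)) F (IsCMField.complexConj F) 2 Jstar)) (hk : k ∈ K.1.1),
      (act δ).hom = (sec42HeckeTranslatesGS S hU7ₛ h4 isoₛ).tr k N N (hn k hk))
    (δ : Δ) {E : SchemeOver ℂ} [Nonempty ↥E.left] (e : E ⟶ (bcFunctor (F : Type) ℂ).obj ((sec42DataGS S h4 isoₛ).X N))
    [IsOpenImmersion e.left] (he : e ≫ (bcFunctor (F : Type) ℂ).map (act δ).hom = e) : act δ = 1 := by
  obtain ⟨k, hk, hδ⟩ := hact δ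
  have hcomm := baseChangeHomObjIsoOfComp_comm (cmConjRingHom F) (algebraMap (F : Type) ℂ) ι₁ hA
    (recordHeckeTranslateGS S hU7ₛ k N N (hn k hk))
  set Θ := baseChangeHomObjIsoOfComp (cmConjRingHom F) (algebraMap (F : Type) ℂ) ι₁ hA (S.M.obj N) with hΘ
  -- the same square in the engine's syntactic form (`bcFunctor`, `tr`), through `.left` components
  have hsq : (bcFunctor (F : Type) ℂ).map (act δ).hom ≫ Θ.hom = Θ.hom ≫ (baseChangeHom ι₁).map
      (recordHeckeTranslateGS S hU7ₛ k N N (hn k hk)) := by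
    rw [hδ, sec42HeckeTranslatesGS_tr]
    refine Over.OverMorphism.ext ?_
    have h2 := congrArg CommaMorphism.left hcomm
    simp only [Over.comp_left] at h2 ⊢
    exact h2
  have hTk : recordHeckeTranslateGS S hU7ₛ k N N (hn k hk) = 𝟙 _ := by
    haveI : IsOpenImmersion (e ≫ Θ.hom).left := by
      rw [Over.comp_left]
      infer_instance
    refine S.heckeTranslate_eq_id_of_comp_eq (isHeckeTranslate_recordHeckeTranslateGS S hU7ₛ k N N (hn k hk)) (e ≫ Θ.hom) ?_
    -- through `.left` components (kernel hygiene: `bcFunctor F ℂ` vs `baseChangeHom (algebraMap F ℂ)` are defeq, not syntactic)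
    refine Over.OverMorphism.ext ?_
    have h2 := congrArg CommaMorphism.left hcomm
    have h3 := congrArg CommaMorphism.left he
    rw [hδ, sec42HeckeTranslatesGS_tr] at h3
    simp only [Over.comp_left, Category.assoc] at h2 h3 ⊢
    refine (congrArg (e.left ≫ ·) h2.symm).trans ?_
    exact (Category.assoc _ _ _).symm.trans (congrArg (· ≫ Θ.hom.left) h3)
  refine Iso.ext ?_
  rw [hδ, sec42HeckeTranslatesGS_tr, hTk, CategoryTheory.Functor.map_id]
  rfl

include hLQ in
/-- **HEAD OF RECORD (s214 (4)) — `socketRosH_GS_of_FR_FP2`**: at every small level `K` the Hecke image `H_K ⊆ End⁰(A_K)` of the GS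
tower carries a positive anti-involution, from the printed FACTS (F-R) `hFR` and (F-P2) `hFP2`.  Composition ★ only: the complex-Jacobian
biproduct model ★ `Albanese.exists_complexJacobian_biproduct_theta_cofan` at the place `ῑ₁`, ★ (J-b) `IsIsogeny.exists_endAlgebra_algEquiv`,
★ (C2)′ `exists_isPositiveAntiInvolution_of_injective_of_levelAdjoint'` at `A := Y`, `hgen` by `adjoin_coe_preimage_eq_top`, per generator
★ `exists_levelAdjoint_letters_GS` (A-p18 (g12), BARE `A3Liu418GSRosHLetters`) with `hPF := translateRigidity_GS`.  `rosHShape_of_FR_FP2 hFR hFP2 : RosHShape := fun … => socketRosH_GS_of_FR_FP2 hFR hFP2 S hU7ₛ hLQ h4 isoₛ`.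
[cite: Liu2021, §4.2] [cite: MumfordAV1970, §21] -/
theorem socketRosH_GS_of_FR_FP2
    (hFR : Literature.AlgebraicGeometry.Motives.Jacobian.riemann_brillNoetherLocus_isPrincipalPolarizationDivisor)
    (hFP2 : Literature.AlgebraicGeometry.Motives.Jacobian.galoisCover_pullback_isWeilPairingAdjoint_norm) :
    ∀ K : C5.SmallLevel K₀,
      ∃ τ : ↥((sec42HeckeTranslatesGS S hU7ₛ h4 isoₛ).heckeImage (isogenyDescent_GS S hU7ₛ hLQ h4 isoₛ) K) →ₗ[ℚ] ↥((sec42HeckeTranslatesGS S hU7ₛ h4 isoₛ).heckeImage (isogenyDescent_GS S hU7ₛ hLQ h4 isoₛ) K),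
        IsPositiveAntiInvolution ↥((sec42HeckeTranslatesGS S hU7ₛ h4 isoₛ).heckeImage (isogenyDescent_GS S hU7ₛ hLQ h4 isoₛ) K) τ := by
  -- the complex place `ῑ₁` (★ `albTransitionEpi_GS`): `X_K ⊗_{ῑ₁} ℂ ≅ M_K ⊗_{ι₁} ℂ`, where the record is uniformised
  letI : Algebra (F : Type) ℂ := ((starRingEnd ℂ).comp ι₁).toAlgebra
  have hA : (algebraMap (F : Type) ℂ).comp (cmConjRingHom F) = ι₁ := RingHom.ext fun x => by
    change (starRingEnd ℂ) (ι₁ (cmConjRingHom F x)) = ι₁ x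
    rw [embedding_cmConjRingHom, starRingEnd_self_apply]
  intro K
  haveI : SmoothOfRelativeDimension 1 ((sec42DataGS S h4 isoₛ).X K).hom := (sec42DataGS S h4 isoₛ).cpt.smooth_X K
  obtain ⟨C, _, E', hE', J', Y, πY, ιY, h1, h2, h3, v, hv, eY, lY, hi, hα, W, hW, Θ', hΘ', hp, hcof, hirr⟩ :=
    Literature.NumberTheory.Automorphic.Liu2021.AppendixC.Albanese.exists_complexJacobian_biproduct_theta_cofan hFR
      ((sec42DataGS S h4 isoₛ).X K) ((sec42DataGS S h4 isoₛ).cpt.projective_X K) ((sec42DataGS S h4 isoₛ).alb K)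
  obtain ⟨e, he, -⟩ := IsIsogeny.exists_endAlgebra_algEquiv hv
  set H := (sec42HeckeTranslatesGS S hU7ₛ h4 isoₛ).heckeImage (isogenyDescent_GS S hU7ₛ hLQ h4 isoₛ) K with hH_def
  set ρ : ↥H →ₐ[ℚ] Y.endAlgebra :=
    ((e.symm : _ →ₐ[ℚ] Y.endAlgebra).comp (endAlgebraBaseChange ℂ ((sec42DataGS S h4 isoₛ).A K))).comp H.val with hρ_def
  have hρ : Function.Injective ρ :=
    (e.symm.injective.comp (endAlgebraBaseChange_injective _)).comp Subtype.val_injective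
  refine exists_isPositiveAntiInvolution_of_injective_of_levelAdjoint' Y hΘ' ρ hρ
    (G := (Subtype.val : ↥H → ((sec42DataGS S h4 isoₛ).A K).endAlgebra) ⁻¹' Set.range ((sec42HeckeTranslatesGS S hU7ₛ h4 isoₛ).heckeEnd (isogenyDescent_GS S hU7ₛ hLQ h4 isoₛ) K))
    (adjoin_coe_preimage_eq_top _) fun g hg => ?_
  obtain ⟨γ₀, hγ₀⟩ := hg
  obtain ⟨q, x, xd, d, c, h1', hd, h2', h3'⟩ := exists_levelAdjoint_letters_GS S hU7ₛ hLQ h4 isoₛ hFR hFP2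
    (fun N K' hn Δ _ act hact δ P _ e' _ he' => translateRigidity_GS S hU7ₛ h4 isoₛ hA N hn act hact δ e' he')
    K C E' hE' J' Y πY ιY h1 h2 h3 v hv eY lY hi hα W hW Θ' hΘ' hp hcof hirr e he γ₀
  refine ⟨q, x, xd, d, c, ?_, hd, h2', h3'⟩
  change e.symm (endAlgebraBaseChange ℂ ((sec42DataGS S h4 isoₛ).A K) (g : ((sec42DataGS S h4 isoₛ).A K).endAlgebra)) = _
  rw [← hγ₀]
  exact h1'

end Glue

end Summit.HodgeConjecture.CorCM.Lines.A3Liu418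

end
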